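import Literature.NumberTheory.EllipticCurves.KellerYin2024.LatticeCharacters
import Literature.NumberTheory.EllipticCurves.GoodReductionUnramifiedProofs
import Literature.NumberTheory.EllipticCurves.HeegnerPointsKolyvaginGoodReductionProofs
import Literature.NumberTheory.EllipticCurves.GaloisActionProofs
import Literature.NumberTheory.EllipticCurves.ModularityVersionApProofs
import Literature.NumberTheory.EllipticCurves.LFunctionPrimeCoeff
import HarnessLib

/-!
# Route `EisensteinPrimes` (rung K5), crux 2 `GoodLatticeBDPValue`, line `halves`, stub
# `stub_muLambda`: the quotient character `𝟙̃` of the lattice is UNRAMIFIED AWAY FROM `N·p`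
# — the Néron–Ogg–Shafarevich half of the displayed input [LOC], IN THE KERNEL

Cell `bsd-eis` (FULL-BSD rank-≤1 programme, `run/shared/lean/pub/bsd-eis/`), seat `bsd-eis-k5-c2`
(D-0074 group (C) row A). In the kernel split of `stub_muLambda`
(`∀ W p, X1.KellerYinHalves.GoodLatticeMuLambdaOnTree W p`) into the character-level statements
[ALG] + [AN] + [BRω] + [BR𝟙] + [LOC] + [F1] (HOME/k5-c2-MEMO-1.md), the input [LOC] says: the
Teichmüller lift `θquot = 𝟙̃` of the character of `Γ_K` on `E[p]/Φ` is unramified at every place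
`w ∤ N_E` of `K`. Its part AWAY FROM `p` is Néron–Ogg–Shafarevich (Silverman VII.4.1: at a place
`w ∤ p` of good reduction the inertia group acts trivially on `E[p]`), and this file PROVES it for
ANY elliptic curve over a number field, any `Γ_K`-stable line `Φ ≤ E[p](K̄)` of order `p` and any
`θ : Γ_K → GL₁(𝓞)` which is the Teichmüller lift of the action on `E[p]/Φ`
(`KellerYin2024.IsTeichmullerLiftOnQuot`, p419246):

* `isUnramifiedAt_of_isTeichmullerLiftOnQuot` — `E/K` with good reduction at `w`, `w ∤ p` ⟹ `θ`
  is unramified at `w` (`FramedGaloisRep.IsUnramifiedAt`: every inertia group `I_𝔓 ≤ Γ_K`, `𝔓 ∣ w`,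
  maps to `1`). Proof: `σ ∈ I_𝔓` fixes `E[p]` pointwise (tree: `smul_eq_of_mem_inertia_of_zsmul_eq_zero`),
  so `(1 − a)·P ∈ Φ` for every `P ∈ E[p]` and the integer `a ≡ θ(σ) (mod 𝔭)` of the predicate; as
  `#E[p] = p² > p = #Φ` (tree: `card_torsionPoints_eq_sq_holds`) some `P ∉ Φ`, forcing `p ∣ 1 − a`;
  hence `‖θ(σ) − 1‖ < 1`, and a `(p − 1)`-st root of unity of `ℚ̄_p` congruent to `1` IS `1`
  (`eq_one_of_pow_eq_one_of_norm_sub_one_lt_one`, Teichmüller rigidity / Hensel).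
* `isUnramifiedAt_baseChange_of_isTeichmullerLiftOnQuot` — for `E = W_K`, `W/ℚ` of conductor `N`:
  `θ` is unramified at every `w` with `w ∤ N` and `w ∤ p` (good reduction of `W` at the prime `ℓ`
  under `w` from `ℓ ∤ N`, tree `dvd_conductorNorm_iff_not_hasGoodReductionAtPrime`, base-changed by
  `hasGoodReductionAt_baseChange_of_hasGoodReductionAt_rat`).

So of [LOC] only the part ABOVE `p` (the étale quotient of ordinary reduction: `Φ` = kernel of
reduction by the good-lattice normalisation, KY Prop. 1.3.1) remains displayed. THEOREMS ONLY; no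
`def`, no named fact, nothing asserted about any particular curve; helper attached to
stmt-BirchSwinnertonDyer-19032 (`--supports`).

References: [SilvermanAEC2009] Prop. VII.4.1(a), Thm. VII.7.1; [KellerYin2024] §1.4 (arXiv:2402.12781v2
TeX L1063–1086), Prop. 1.3.1; [LangCyclotomic1990] Ch. 1 §2; HOME/k5-c2-MEMO-1.md §1 S5, §5 T4.
-/

set_option autoImplicit false
set_option linter.dupNamespace false

noncomputable section

open scoped Classical

open WeierstrassCurve NumberField IsDedekindDomain Field Rat.HeightOneSpectrum
  Literature.NumberTheory.EllipticCurves Literature.NumberTheory.GaloisRepresentations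
  Literature.NumberTheory.EllipticCurves.KellerYin2024

namespace Summit.BirchSwinnertonDyer.BirchSwinnertonDyer.Theorems.EisensteinPrimesMuLambda

/-! ## §1 Teichmüller rigidity in `ℚ̄_p` -/

section Rigidity

variable {p : ℕ} [hp : Fact p.Prime]

/-- `‖x‖ = 1` for a `(p − 1)`-st root of unity `x` of `ℚ̄_p`. [folklore] -/
theorem norm_eq_one_of_pow_sub_one_eq_one {x : PadicAlgCl p} (hx : x ^ (p - 1) = 1) : ‖x‖ = 1 := by
  have h1 : ‖x‖ ^ (p - 1) = 1 := by rw [← norm_pow, hx, norm_one]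
  have hp1 : p - 1 ≠ 0 := Nat.sub_ne_zero_of_lt hp.out.one_lt
  exact (pow_eq_one_iff_of_nonneg (norm_nonneg x) hp1).mp h1

/-- `‖x^i − 1‖ < 1` when `‖x‖ ≤ 1` and `‖x − 1‖ < 1` (ultrametric). [folklore] -/
theorem norm_pow_sub_one_lt_one {x : PadicAlgCl p} (hx : ‖x‖ ≤ 1) (h1 : ‖x - 1‖ < 1) (i : ℕ) :
    ‖x ^ i - 1‖ < 1 := by
  induction i with
  | zero => simp
  | succ i ih =>
    have e : x ^ (i + 1) - 1 = x * (x ^ i - 1) + (x - 1) := by ring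
    rw [e]
    refine (IsUltrametricDist.norm_add_le_max _ _).trans_lt (max_lt ?_ h1)
    rw [norm_mul]
    calc ‖x‖ * ‖x ^ i - 1‖ ≤ 1 * ‖x ^ i - 1‖ := by gcongr
      _ < 1 := by rw [one_mul]; exact ih

/-- **Teichmüller rigidity**: a `(p − 1)`-st root of unity of `ℚ̄_p` congruent to `1` modulo the
maximal ideal IS `1` (distinct Teichmüller representatives are distinct mod `𝔭`; Hensel).
Proof: `(x − 1)·Σ_{i<p−1} xⁱ = x^{p−1} − 1 = 0` and `Σ_{i<p−1} xⁱ ≡ p − 1 ≢ 0`.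
[cite: LangCyclotomic1990, Ch. 1 §2 (Teichmüller character)] -/
theorem eq_one_of_pow_eq_one_of_norm_sub_one_lt_one {x : PadicAlgCl p} (hx : x ^ (p - 1) = 1)
    (h1 : ‖x - 1‖ < 1) : x = 1 := by
  have hnx : ‖x‖ = 1 := norm_eq_one_of_pow_sub_one_eq_one hx
  -- the geometric sum `S = Σ_{i<p-1} x^i` has norm `1`
  set S : PadicAlgCl p := ∑ i ∈ Finset.range (p - 1), x ^ i with hS
  have hS1 : ‖S - ((p - 1 : ℕ) : PadicAlgCl p)‖ < 1 := by
    have e : S - ((p - 1 : ℕ) : PadicAlgCl p) = ∑ i ∈ Finset.range (p - 1), (x ^ i - 1) := by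
      rw [Finset.sum_sub_distrib, Finset.sum_const, Finset.card_range, nsmul_eq_mul, mul_one]
    rw [e]
    have hne : (Finset.range (p - 1)).Nonempty :=
      ⟨0, Finset.mem_range.mpr (Nat.sub_pos_of_lt hp.out.one_lt)⟩
    refine (hne.norm_sum_le_sup'_norm _).trans_lt ((Finset.sup'_lt_iff hne).mpr fun i _ ↦ ?_)
    exact norm_pow_sub_one_lt_one hnx.le h1 i
  have hp1 : ‖((p - 1 : ℕ) : PadicAlgCl p)‖ = 1 := by
    rw [show ((p - 1 : ℕ) : PadicAlgCl p) = ((p - 1 : ℕ) : ℚ_[p]) by push_cast; rfl,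
      PadicAlgCl.norm_extends]
    -- `p - 1` is a `p`-adic unit
    have h1lt := hp.out.one_lt
    have h : ¬ p ∣ (p - 1) := fun h ↦ by
      have := Nat.le_of_dvd (Nat.sub_pos_of_lt h1lt) h
      omega
    exact Padic.norm_natCast_eq_one_iff.mpr ((Nat.Prime.coprime_iff_not_dvd hp.out).mpr h)
  have hSn : ‖S‖ = 1 := by
    have e : S = ((p - 1 : ℕ) : PadicAlgCl p) + (S - ((p - 1 : ℕ) : PadicAlgCl p)) := by ring
    rw [e, IsUltrametricDist.norm_add_eq_max_of_norm_ne_norm (by rw [hp1]; exact hS1.ne'),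
      hp1, max_eq_left hS1.le]
  have hS0 : S ≠ 0 := fun h ↦ by rw [h, norm_zero] at hSn; exact zero_ne_one hSn
  -- `(x - 1) * S = 0`
  have hmul : S * (x - 1) = 0 := by rw [hS, geom_sum_mul, hx, sub_self]
  rcases mul_eq_zero.mp hmul with h | h
  · exact absurd h hS0
  · exact sub_eq_zero.mp h

end Rigidity

/-! ## §2 Rank-one plumbing: `θ σ = 1` from its entry -/

section RankOne

variable {K : Type} [Field K] {p : ℕ} [Fact p.Prime] (S : Set (PadicAlgCl p))

/-- The entry of `θ σ` is the determinant of the `1 × 1` matrix `θ σ`. [folklore] -/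
theorem entry_eq_det (θ : FramedGaloisRep K (padicCoeffIntegers S) 1) (σ : absoluteGaloisGroup K) :
    entry S θ σ = ((Matrix.GeneralLinearGroup.det (θ σ) : (padicCoeffIntegers S)ˣ) :
      padicCoeffIntegers S) := by
  rw [Matrix.GeneralLinearGroup.val_det_apply, Matrix.det_fin_one]
  rfl

/-- If `(θ σ)^k = 1` then `(entry θ σ)^k = 1` (the determinant is multiplicative). [folklore] -/
theorem entry_pow_eq_one_of_pow_eq_one (θ : FramedGaloisRep K (padicCoeffIntegers S) 1)
    (σ : absoluteGaloisGroup K) {k : ℕ} (h : θ σ ^ k = 1) : entry S θ σ ^ k = 1 := by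
  rw [entry_eq_det, ← Units.val_pow_eq_pow_val, ← map_pow, h, map_one, Units.val_one]

/-- A `1 × 1` invertible matrix with entry `1` is `1`. [folklore] -/
theorem apply_eq_one_of_entry_eq_one (θ : FramedGaloisRep K (padicCoeffIntegers S) 1)
    (σ : absoluteGaloisGroup K) (h : entry S θ σ = 1) : θ σ = 1 := by
  refine Matrix.GeneralLinearGroup.ext fun i j ↦ ?_
  rw [Subsingleton.elim i 0, Subsingleton.elim j 0, Units.val_one, Matrix.one_apply_eq]
  exact h

end RankOne

/-! ## §3 [LOC] away from `p`: Néron–Ogg–Shafarevich for the quotient character -/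

section Away

variable {K : Type} [Field K] [NumberField K] (WK : WeierstrassCurve K) [WK.IsElliptic]
  {p : ℕ} [hp : Fact p.Prime] (S : Set (PadicAlgCl p))

/-- `E[p](K̄)` is strictly bigger than any subgroup of order `p`: there is a `p`-torsion point
outside `Φ` (`#E[p] = p²`, tree `card_torsionPoints_eq_sq_holds`). [cite: SilvermanAEC2009, Cor. III.6.4(b)] -/
theorem exists_mem_geomTorsion_notMem {Φ : AddSubgroup (geomPoints WK)} (hcard : Nat.card Φ = p) :
    ∃ P ∈ geomTorsion WK (p : ℤ), P ∉ Φ := by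
  by_contra h
  push Not at h
  have hle : geomTorsion WK (p : ℤ) ≤ Φ := fun P hP ↦ h P hP
  have hT : Nat.card (geomTorsion WK (p : ℤ)) = p ^ 2 :=
    card_torsionPoints_eq_sq_holds WK (AlgebraicClosure K) (n := p)
      (by exact_mod_cast hp.out.ne_zero)
  have hfin : Finite Φ := Nat.finite_of_card_ne_zero (by rw [hcard]; exact hp.out.ne_zero)
  have hdvd : Nat.card (geomTorsion WK (p : ℤ)) ∣ Nat.card Φ :=
    AddSubgroup.card_dvd_of_le hle
  rw [hT, hcard, sq] at hdvd
  have := Nat.le_of_dvd hp.out.pos hdvd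
  have h1 := hp.out.one_lt
  nlinarith

omit [NumberField K] [WK.IsElliptic] in
/-- If `b·P ∈ Φ` for some `p`-torsion `P ∉ Φ`, then `p ∣ b`. [folklore] -/
theorem prime_dvd_of_zsmul_mem {Φ : AddSubgroup (geomPoints WK)} {P : geomPoints WK}
    (hP : P ∈ geomTorsion WK (p : ℤ)) (hPΦ : P ∉ Φ) {b : ℤ} (hb : b • P ∈ Φ) : (p : ℤ) ∣ b := by
  by_contra hnd
  have hcop : IsCoprime (p : ℤ) b :=
    (Prime.coprime_iff_not_dvd (Nat.prime_iff_prime_int.mp hp.out)).mpr hnd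
  obtain ⟨u, v, huv⟩ := hcop
  apply hPΦ
  have e : P = u • ((p : ℤ) • P) + v • (b • P) := by
    rw [← mul_smul, ← mul_smul, ← add_smul, huv, one_smul]
  rw [e, (mem_geomTorsion_iff WK _ P).mp hP, smul_zero, zero_add]
  exact Φ.zsmul_mem hb v

/-- **[LOC] away from `p` — Néron–Ogg–Shafarevich for `𝟙̃`.** For an elliptic curve `E` over a
number field `K`, a prime `p`, a subgroup `Φ ≤ E(K̄)` of order `p`, and a character
`θ : Γ_K → GL₁(𝓞)` which is the Teichmüller lift of the action of `Γ_K` on `E[p]/Φ`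
(`IsTeichmullerLiftOnQuot S Φ E[p] θ`): at every finite place `w ∤ p` of good reduction, `θ` is
UNRAMIFIED. (Silverman VII.4.1(a): `I_𝔓` acts trivially on `E[p]`, hence by an integer `a ≡ 1 (p)`
on `E[p]/Φ ≠ 0`; the Teichmüller lift of `1` is `1`.)
[cite: SilvermanAEC2009, Prop. VII.4.1(a)] [cite: KellerYin2024, §1.4 (arXiv:2402.12781v2 TeX L1063–1086: ψ on ρ̄_f/𝔽(φ))] -/
theorem isUnramifiedAt_of_isTeichmullerLiftOnQuot {Φ : AddSubgroup (geomPoints WK)}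
    (hcard : Nat.card Φ = p) {θ : FramedGaloisRep K (padicCoeffIntegers S) 1}
    (hθ : IsTeichmullerLiftOnQuot S Φ (geomTorsion WK (p : ℤ)) θ)
    {w : HeightOneSpectrum (𝓞 K)} (hw : WK.HasGoodReductionAt w)
    (hpw : ((p : ℕ) : 𝓞 K) ∉ w.asIdeal) : θ.IsUnramifiedAt w := by
  intro 𝔓 h𝔓 σ hσ
  obtain ⟨a, ha, hΦ⟩ := hθ.2 σ
  -- `σ ∈ I_𝔓` fixes `E[p]` pointwise
  have hfix : ∀ P ∈ geomTorsion WK (p : ℤ), σ • P = P := fun P hP ↦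
    WK.smul_eq_of_mem_inertia_of_zsmul_eq_zero hw (n := (p : ℤ)) (by exact_mod_cast hpw) h𝔓 hσ
      ((mem_geomTorsion_iff WK _ P).mp hP)
  -- hence `(1 - a) • P ∈ Φ` on `E[p]`, and `p ∣ 1 - a`
  obtain ⟨P, hP, hPΦ⟩ := exists_mem_geomTorsion_notMem WK (p := p) hcard
  have h1a : (1 - a) • P ∈ Φ := by
    have h := hΦ P hP
    rw [hfix P hP] at h
    rw [sub_smul, one_smul]
    exact h
  have hdvd : (p : ℤ) ∣ 1 - a := prime_dvd_of_zsmul_mem WK hP hPΦ h1a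
  -- `‖a - 1‖ < 1` in `ℚ̄_p`
  have ha1 : ‖(a : PadicAlgCl p) - 1‖ < 1 := by
    rw [← norm_neg, neg_sub, show (1 : PadicAlgCl p) - a = (((1 - a : ℤ) : ℚ_[p]) : PadicAlgCl p) by
      push_cast; rfl, PadicAlgCl.norm_extends]
    exact Padic.norm_intCast_lt_one_iff.mpr hdvd
  -- `‖θ(σ) - 1‖ < 1`
  have he1 : ‖((entry S θ σ : padicCoeffIntegers S) : PadicAlgCl p) - 1‖ < 1 := by
    have e : ((entry S θ σ : padicCoeffIntegers S) : PadicAlgCl p) - 1 =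
        (((entry S θ σ : padicCoeffIntegers S) : PadicAlgCl p) - a) + ((a : PadicAlgCl p) - 1) := by
      ring
    rw [e]
    exact (IsUltrametricDist.norm_add_le_max _ _).trans_lt (max_lt ha ha1)
  -- `θ(σ)^{p-1} = 1`, so `θ(σ) = 1`
  have hpow : ((entry S θ σ : padicCoeffIntegers S) : PadicAlgCl p) ^ (p - 1) = 1 := by
    have h := congrArg ((↑) : padicCoeffIntegers S → PadicAlgCl p)
      (entry_pow_eq_one_of_pow_eq_one S θ σ (hθ.1 σ))
    push_cast at h
    exact h
  have hone : ((entry S θ σ : padicCoeffIntegers S) : PadicAlgCl p) = 1 :=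
    eq_one_of_pow_eq_one_of_norm_sub_one_lt_one hpow he1
  exact apply_eq_one_of_entry_eq_one S θ σ (Subtype.ext hone)

end Away

/-! ## §4 The base change `E = W_K` of a curve over `ℚ`: unramified at `w ∤ N·p` -/

section BaseChange

variable {K : Type} [Field K] [NumberField K] (W : WeierstrassCurve ℚ) [W.IsElliptic]
  {p : ℕ} [hp : Fact p.Prime] (S : Set (PadicAlgCl p))

/-- **Good reduction of `W_K` at a place `w ∤ N_W`.** The rational prime `ℓ` under `w` does not
divide the conductor (else `N ∈ w`), so `W` has good reduction at `ℓ`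
(`dvd_conductorNorm_iff_not_hasGoodReductionAtPrime`) and `W_K` at `w`
(`hasGoodReductionAt_baseChange_of_hasGoodReductionAt_rat`).
[cite: SilvermanAEC2009, VII.5 Prop. 5.1(a) and VIII.8 Cor. 8.3 (base change of good reduction)] -/
theorem hasGoodReductionAt_baseChange_of_conductorNorm_notMem (w : HeightOneSpectrum (𝓞 K))
    (hw : ((W.conductorNorm ℤ : ℤ) : 𝓞 K) ∉ w.asIdeal) : (W.baseChange K).HasGoodReductionAt w := by
  -- the place `v` of `ℚ` under `w` and its prime `ℓ`
  set v : HeightOneSpectrum (𝓞 ℚ) := w.under (𝓞 ℚ) with hv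
  haveI : w.asIdeal.LiesOver v.asIdeal := ⟨rfl⟩
  haveI := Fact.mk (primesEquiv v).2
  have hℓv : ((primesEquiv v : ℕ) : 𝓞 ℚ) ∈ v.asIdeal :=
    (natCast_mem_asIdeal_iff_eq_primesEquiv_symm v (primesEquiv v).2).mpr
      (by rw [Subtype.coe_eta, Equiv.symm_apply_apply])
  have hℓw : ((primesEquiv v : ℕ) : 𝓞 K) ∈ w.asIdeal := by
    have h : algebraMap (𝓞 ℚ) (𝓞 K) ((primesEquiv v : ℕ) : 𝓞 ℚ) ∈ w.asIdeal := by
      rw [← Ideal.mem_comap]; exact hℓv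
    rwa [map_natCast] at h
  -- `ℓ ∤ N`
  have hℓN : ¬ (primesEquiv v : ℕ) ∣ W.conductorNorm ℤ := by
    rintro ⟨c, hc⟩
    apply hw
    rw [hc]; push_cast
    exact w.asIdeal.mul_mem_right _ hℓw
  have hgood : W.HasGoodReductionAtPrime (primesEquiv v) := by
    by_contra h
    exact hℓN ((W.dvd_conductorNorm_iff_not_hasGoodReductionAtPrime (primesEquiv v)).mpr h)
  have hgoodv : W.HasGoodReductionAt v :=
    (W.hasGoodReductionAtPrime_iff_hasGoodReductionAt_ringOfIntegers v).mp hgood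
  exact hasGoodReductionAt_baseChange_of_hasGoodReductionAt_rat W v w hgoodv

/-- **[LOC] away from `p` for the base change of a curve over `ℚ`.** For `W/ℚ` elliptic of
conductor `N`, a number field `K`, a subgroup `Φ ≤ W(K̄)` of order `p` and a character
`θ : Γ_K → GL₁(𝓞)` which is the Teichmüller lift of the action on `W[p]/Φ`: `θ` is unramified at
every place `w` of `K` with `w ∤ N` and `w ∤ p`. The Néron–Ogg–Shafarevich half of the displayed
input [LOC] (`X1.KellerYinMuLambdaSplit.GoodLatticeQuotCharUnramifiedOnTree`) of the kernel split of
`stub_muLambda`; the half ABOVE `p` (étale quotient of ordinary reduction) stays displayed.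
[cite: SilvermanAEC2009, Prop. VII.4.1(a), Thm. VII.7.1] [cite: KellerYin2024, §1.4 (arXiv:2402.12781v2 TeX L1063–1086)] -/
theorem isUnramifiedAt_baseChange_of_isTeichmullerLiftOnQuot
    {Φ : AddSubgroup (geomPoints (W.baseChange K))} (hcard : Nat.card Φ = p)
    {θ : FramedGaloisRep K (padicCoeffIntegers S) 1}
    (hθ : IsTeichmullerLiftOnQuot S Φ (geomTorsion (W.baseChange K) (p : ℤ)) θ)
    (w : HeightOneSpectrum (𝓞 K)) (hw : ((W.conductorNorm ℤ : ℤ) : 𝓞 K) ∉ w.asIdeal)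
    (hpw : ((p : ℕ) : 𝓞 K) ∉ w.asIdeal) : θ.IsUnramifiedAt w :=
  isUnramifiedAt_of_isTeichmullerLiftOnQuot (W.baseChange K) S hcard hθ
    (hasGoodReductionAt_baseChange_of_conductorNorm_notMem W w hw) hpw

end BaseChange

end Summit.BirchSwinnertonDyer.BirchSwinnertonDyer.Theorems.EisensteinPrimesMuLambda

end
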